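import Mathlib
import Summits.NavierStokesRegularity.NavierStokesRegularity.Theses.EulerZoomLiouville
import Summits.NavierStokesRegularity.NavierStokesRegularity.Theorems.EulerZoomLiouvillePowerGaugeEulerLiouvilleSelfSimilarVorticalEscape
import Summits.NavierStokesRegularity.NavierStokesRegularity.Theorems.EulerZoomLiouvillePowerGaugeEulerLiouvilleSelfSimilarBernoulliFeeding
import Summits.NavierStokesRegularity.NavierStokesRegularity.Theorems.EulerZoomLiouvillePowerGaugeEulerLiouvilleSelfSimilarHalfOrbitKit
import Summits.NavierStokesRegularity.NavierStokesRegularity.Theorems.EulerZoomLiouvillePowerGaugeEulerLiouvilleLastExitStayersReturn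
import Summits.NavierStokesRegularity.NavierStokesRegularity.Theorems.EulerZoomLiouvillePowerGaugeEulerLiouvilleLastExitCofinalReturner
import Summits.NavierStokesRegularity.NavierStokesRegularity.Theorems.EulerZoomLiouvillePowerGaugeEulerLiouvilleLastExitLateReturns
import Literature.Analysis.FluidPDE.DecayingSelfSimilarEulerProfile
import Literature.Analysis.FluidPDE.VectorCalculus
import HarnessLib.Audit

/-!
# Line `last_exit` — THE LAST EXIT FROM THE NEAR BALL: «SPIKES OR HOVERING» AS A MEMBER, WITHOUT THE BAND DEFICIT
# (ns-idea-11 g8, LINE g8-2; lens «complete»: the LEAD-named gap «near-origin hovering loophole» of RESIDUE-MEMO-19832-g13 §2/§3 T-D)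

Crux `EulerZoomLiouville.PowerGaugeEulerLiouville` = stmt-NavierStokesRegularity-19832, registered residue
`Birth.stub_selfSimilarC2Needle` (THE ONE STATEMENT, `Lines/birth.lean` ★ v93 sha16 d6629864d4248921, LEAD ns-typeII-p2 g14).  Files only:
this line composes BY NAME to the verbatim copy `Sig.stub_selfSimilarC2Needle` below (all 9 shared predicates character-identical to v93, script-checked;
REV2 STATUS: ALL THREE PROVABLE STUBS ARE TREE THEOREMS — LE1 `LastExit.stayersReturn` (ns-ezl-w1 g6 p680758), LE2a `LastExit.cofinalReturnerBounded`
(ns-ezl-w3 g6 p680805 = ns-ezl-w1 g6 p680963), LE2b `LastExit.lateReturnsVanish` (ns-ezl-w3 g6) — wired by `exact`; the 2 sorries are exactly the two OPEN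
faces `stub_hoverFace` (T-E) and `stub_spikeFace`; i.e. the MEMBER «spikes or hovering ⇒ local power clock» is now a sorry-free theorem of this file)
and produces the verbatim ALTERNATIVE (6) of `Birth.HasResidenceClock` (v88 LOCAL power clock); it never touches
`Lines/birth.lean`.  No summit is proved by a line; 19832 is OPEN; NS regularity is NOT proved.

## The gap it completes (cited)
RESIDUE-MEMO-19832-g13 §2 (LEAD, 2026-08-28T23:28Z): «THE NEEDLE IS A HOVERING/CONDENSER OBJECT OR A BERNOULLI-SPIKE OBJECT … a
formal member «no-hovering + envelope ⇒ trivial» is NOT in the tree: the near-origin hovering loophole (returns into the near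
ball after slow outflow creep) blocks the 3-line corollary — see §3 T-D», and §3 T-D plans it WITH the full-band deficit via T-C
(no return) + alternative-(5) bookkeeping.  This line closes the loophole WITHOUT the deficit and without T-C.

## The lever (one sentence)
THE LAST EXIT TIME from the near ball `B(0,R₁)`: along a backward similarity orbit `ℋ` is non-decreasing (CIV (3.31)), so an
orbit that RETURNS to `B(0,R₁)` at arbitrarily late times has a BOUNDED limit level `L ≤ max_{B̄(0,R₁)} ℋ`, hence FINITE total
action `∫₀^∞‖W‖² = (L − ℋ(y))/(1−2γ)`; but almost every vortical label comes from infinity (W3b,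
`Loc.ae_not_boundedBackward_of_curl_ne_zero`), and under «NO FAR HOVERING above level h» (`‖W‖ ≥ w₀` at far vortical points of
`{ℋ > h}`) every excursion from `B(0,R₁)` to radius `N` and back costs action `≥ w₀ · (2(N − R₁))` (`∫‖W‖² ≥ w₀∫‖W‖ = w₀·length`):
infinitely many unbounded excursions cost infinite action.  So a.e. high vortical label has a FINITE LAST EXIT TIME `σ₀(y)`,
after which it is far forever, never hovers, and its Bernoulli value grows at least linearly, `ℋ(Y σ) ≥ h + (1−2γ)w₀²(σ − σ₀)`.
If moreover the vortical Bernoulli levels carry NO SPIKES (`ℋ ≤ h + C R^θ` at vortical points of `{ℋ > h} ∩ B̄(0,2R)`, `θ < 2+ρ`),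
a label cannot stay in `B̄(0,2R)` longer than `σ₀(y) + C R^θ/((1−2γ)w₀²) = σ₀(y) + o(R^{2+ρ})`: the stay-volume of ONE ball for
time `c′R^{2+ρ}` tends to `0` — the v88 LOCAL POWER CLOCK (alternative (6) of `HasResidenceClock`), for EVERY `c′`.

## What is typed (sorries = stubs; the member's assembly and the needle composition are kernel-checked)
* `stub_stayersReturn` — CLOSED (REV2: tree theorem `LastExit.stayersReturn`, ns-ezl-w1 g6 p680758; was PROVABLE M): a label of `{curl V ≠ 0} ∩ {ℋ > h}` whose cut-off backward orbit
  stays in `B̄(0,2R)` on `[0,T]` visits `B(0,R₁)` in every time window of length `D` with `m − h ≤ (1−2γ)w₀²D`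
  (`m` = a bound for `ℋ` on vortical high points of `B̄(0,2R)`).  Tools BY NAME: `ChannelClock.bernoulli_le_of_arc` (monotone `ℋ`),
  the arc identity behind it (`IsSelfSimilarEulerProfile.fderiv_selfSimilarBernoulli_transport`, (3.31)),
  `OutflowDive.vorticityTransport` ((3.4)), ODE uniqueness inside `ball 0 R_big` as in `ChannelClock.logClock_of_channel`.
* `stub_cofinalReturnerBounded` — CLOSED (REV2: tree theorem `LastExit.cofinalReturnerBounded`, ns-ezl-w3 g6 p680805 = ns-ezl-w1 g6 p680963;
  THE LEVER, was PROVABLE M): under no-far-hovering above `h`, a global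
  backward `W`-half-orbit from a vortical point of `{ℋ > h}` that returns to `B(0,R₁)` at arbitrarily late times is BOUNDED
  (verbatim the orbit shape of W3b `Loc.volume_vortical_boundedBackward_eq_zero`).  Tools: `Loc.bernoulli_comp_sub_eq_of_Ici`,
  `OutflowDive.vorticityTransport`, continuity of `ℋ` on the compact `B̄(0,R₁)`, arc length `≤ ∫‖Y′‖`.
* `stub_lateReturnsVanish` — CLOSED (REV2: the content is the tree theorem `LastExit.lateReturnsVanish`, ns-ezl-w3 g6, tools
  `…LastExitLateReturnsTools`; stated AS AN IMPLICATION from `Sig.stub_cofinalReturnerBounded`, was PROVABLE L):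
  the volume of labels of a small ball around a vortical `x₀ ∈ {ℋ > h}` whose cut-off orbit stays in `B̄(0,2R)` up to a LATE time
  `σ ≥ S` at which it is in `B(0,R₁)` is `≤ ε·vol(ball)` for `S ≥ S₀(ε)`, uniformly in `R` and in the cut-off copy (the sets decrease
  in `S`; their intersection is the set of global cofinal returners, inside W3b's NULL set by the previous stub — exactly step (i) of
  `ChannelClock.logClock_of_channel` with «confined» replaced by «returns late»).
* `member_of` — KERNEL-CHECKED ASSEMBLY (no sorry): the three stubs give the MEMBER `Sig.memberSpikesOrHovering`:
  no far hovering above `h` + no vortical spikes above `h` (`θ < 2+ρ`) + one vortical `x₀` with `ℋ(x₀) > h` ⇒ `LocalPowerClock ρ V`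
  (= alternative (6) verbatim), hence `HasResidenceClock ρ V` (`hasResidenceClock_of_localPowerClock`, `Or.inr⁵ ∘ Or.inl`,
  kernel-checked against the v93 copy: the sixth of eight disjuncts).
* `stub_hoverFace` — OPEN (XL) = the LEAD's condenser face T-E in the weakest form the member needs («below every vortical value,
  far high vortical points do not hover»); `stub_spikeFace` — OPEN (L) = «NO BERNOULLI SPIKES on vortical high points» above SOME level
  below `ℋ(x₀)` (growth exponent `θ < 2+ρ`; REV1 = the weakest form the member consumes; the LEAD's spike object of §2).
* `selfSimilarC2Needle_of : stub_stayersReturn → stub_cofinalReturnerBounded → stub_lateReturnsVanish → stub_hoverFace →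
  stub_spikeFace → Sig.stub_selfSimilarC2Needle` (kernel-checked): `¬ HasBernoulliPiercing` supplies `P′` and a vortical `x₀`,
  the spike face picks `h < ℋ(x₀)`, the hovering face answers at `h`, the member supplies alternative (6), `¬ HasResidenceClock` closes.
After this line the typed needle is «HOVERING ∨ SPIKES» as a theorem-shaped reduction (two named open faces), not a diagnosis.
No summit is proved by a line; DENT 0; 19832 OPEN.
-/

open MeasureTheory Set Filter Topology Metric
open scoped ENNReal NNReal ContDiff

set_option linter.dupNamespace false


namespace Summit.NavierStokesRegularity.NavierStokesRegularity.Cruxes.PowerGaugeEulerLiouville.LastExit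

/-- Local abbreviation: ℝ³ (verbatim `Birth.E3`). -/
abbrev E3 : Type := EuclideanSpace ℝ (Fin 3)

/-- Membership in Seregin's power-gauged ancient Euler class (verbatim `Birth.InClass`, `Lines/birth.lean` v78). -/
@[reducible] def InClass (ρ : ℝ) (u : ℝ → E3 → E3) (p : ℝ → E3 → ℝ) (H : ℝ → E3 → E3 →L[ℝ] E3)
    (c : ℝ≥0) : Prop :=
  Literature.Analysis.FluidPDE.IsSuitableWeakSolutionOn
      (Literature.Analysis.FluidPDE.slab (EuclideanSpace ℝ (Fin 3)) (Set.Iio 0) isOpen_Iio) 0 0 u p ∧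
    Literature.Analysis.FluidPDE.HasWeakSpatialGradientOn
      (Literature.Analysis.FluidPDE.slab (EuclideanSpace ℝ (Fin 3)) (Set.Iio 0) isOpen_Iio) u H ∧
    (∀ a : ℝ, 0 < a →
      ENNReal.ofReal (a ^ (2 * ρ)) * Literature.Analysis.FluidPDE.cknA a (0 : ℝ × E3) u +
          ENNReal.ofReal (a ^ ρ) * Literature.Analysis.FluidPDE.cknE a (0 : ℝ × E3) H +
        ENNReal.ofReal (a ^ (2 * ρ)) * Literature.Analysis.FluidPDE.cknD a (0 : ℝ × E3) p ≤ (c : ℝ≥0∞))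

/-- Exactly self-similar member about the origin with profile `(V, P)` (verbatim `Birth.IsExactlySelfSimilar`, v78). -/
@[reducible] def IsExactlySelfSimilar (ρ : ℝ) (u : ℝ → E3 → E3) (p : ℝ → E3 → ℝ) (V : E3 → E3) (P : E3 → ℝ) :
    Prop :=
  (∀ τ : ℝ, τ < 0 → u τ = Literature.Analysis.FluidPDE.selfSimilarCollapse (1 / (2 + ρ)) 0 V τ) ∧
    (∀ τ : ℝ, τ < 0 → p τ = Literature.Analysis.FluidPDE.selfSimilarCollapsePressure (1 / (2 + ρ)) 0 P τ)

/-- EXTREMAL profile: the `A`-gauge rate is saturated (verbatim `Birth.IsExtremalProfile`, v78). -/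
@[reducible] def IsExtremalProfile (ρ : ℝ) (V : E3 → E3) : Prop :=
  ∃ ε : ℝ, 0 < ε ∧ ∃ L₀ : ℝ, ∀ L : ℝ, L₀ ≤ L →
    ε ≤ L ^ (2 * ρ - 1) * ∫ y in Metric.ball (0 : E3) L, ‖V y‖ ^ 2

/-- Bernoulli piercing on spheres beyond every radius (verbatim `Birth.HasBernoulliPiercing`, v78). -/
@[reducible] def HasBernoulliPiercing (ρ : ℝ) (V : E3 → E3) : Prop :=
  ∀ P' : E3 → ℝ, Literature.Analysis.FluidPDE.IsSelfSimilarEulerProfile (1 / (2 + ρ)) 0 V P' →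
    ∀ h R₀ : ℝ, ∃ R : ℝ, R₀ ≤ R ∧ ∀ y : E3, ‖y‖ = R →
      inner ℝ y (V y) ≤ -(1 / (2 + ρ) * ‖y‖ ^ 2) →
        (Literature.Analysis.FluidPDE.curl V y = 0 ∨
          Literature.Analysis.FluidPDE.selfSimilarBernoulli (1 / (2 + ρ)) 0 V P' y < h)

/-- FAST VORTICAL CHANNEL in one of TWELVE killed senses (verbatim `Birth.HasFastVorticalChannel`, ★ v93; each clause for EVERY classical `P′` and
level `h`, beyond some radius, on the VORTICAL points of `{ℋ_{P′} > h}` unless said otherwise): (1) ONE-SIDED inflow channel at ANY rate `c₁ > 0` (v83, LEAD g13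
`…vorticalChannelC2_profile_anyRate`); (2) INFLOW HALF-BAND DEFICIT (v84, LEAD g13); (3) VIRIAL FORM (v85, ns-ezl-w1 g6); (4) ABSOLUTE INFLOW-BAND DEFICIT
«any inward drift kills» (v86, LEAD g13, POWER clock); (5) h-FREE RADIAL-PRESSURE FORM (v86, ns-sfl-p1 g6); (6) ABSOLUTE VIRIAL form (v87, ns-ezl-w1 g6);
(7) = (4) with DECAYING floor `a ≥ a₀/‖y‖²` (v87, LEAD g13); (8) ABSOLUTE RADIAL-PRESSURE FORM (v89, ns-sfl-p1 g6); (9) rpow POWER BAND `0 ≤ e₁ < ρ`,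
`0 ≤ e₂ < 2+ρ+e₁` (v89, ns-ezl-w1 g6); (10) INVARIANT-REGION band deficit (v90, ns-ezl-w1 g6 `…invariantBandDeficitC2_profile`); (11) POWER BAND DEFICIT AT
ONE LEVEL below ONE vortical point (v91, ns-ezl-w1 g6 `…powerBandDeficitC2_level`); (12) = (10) with the deficit allowed to FAIL on an exceptional set that a.e.
backward arc of the invariant region AVOIDS (v93, LEAD g14 ← ns-ezl-w1 g6 T-I `…avoidingBandDeficitC2_profile`). -/
@[reducible] def HasFastVorticalChannel (ρ : ℝ) (V : E3 → E3) : Prop :=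
  (∃ c₁ : ℝ, 0 < c₁ ∧
    ∀ P' : E3 → ℝ, Literature.Analysis.FluidPDE.IsSelfSimilarEulerProfile (1 / (2 + ρ)) 0 V P' →
      ∀ h : ℝ, ∃ R₀ : ℝ, ∀ y : E3, R₀ ≤ ‖y‖ → h < Literature.Analysis.FluidPDE.selfSimilarBernoulli (1 / (2 + ρ)) 0 V P' y →
        Literature.Analysis.FluidPDE.curl V y ≠ 0 →
          inner ℝ y (Literature.Analysis.FluidPDE.selfSimilarTransport (1 / (2 + ρ)) 0 V y) ≤ -(c₁ * ‖y‖ ^ 2)) ∨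
  (∃ c₁ μ : ℝ, 0 < c₁ ∧ 0 < μ ∧
    ∀ P' : E3 → ℝ, Literature.Analysis.FluidPDE.IsSelfSimilarEulerProfile (1 / (2 + ρ)) 0 V P' →
      ∀ h : ℝ, ∃ R₀ : ℝ, ∀ y : E3, R₀ ≤ ‖y‖ → h < Literature.Analysis.FluidPDE.selfSimilarBernoulli (1 / (2 + ρ)) 0 V P' y →
        Literature.Analysis.FluidPDE.curl V y ≠ 0 →
          -(c₁ * ‖y‖ ^ 2) ≤ inner ℝ y (Literature.Analysis.FluidPDE.selfSimilarTransport (1 / (2 + ρ)) 0 V y) →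
          inner ℝ y (Literature.Analysis.FluidPDE.selfSimilarTransport (1 / (2 + ρ)) 0 V y) ≤ 0 →
          (2 * c₁ ^ 2 + μ) * ‖y‖ ^ 2 ≤ ‖Literature.Analysis.FluidPDE.selfSimilarTransport (1 / (2 + ρ)) 0 V y‖ ^ 2 +
            (1 / (2 + ρ)) * inner ℝ y (Literature.Analysis.FluidPDE.selfSimilarTransport (1 / (2 + ρ)) 0 V y) +
            inner ℝ y (fderiv ℝ V y (Literature.Analysis.FluidPDE.selfSimilarTransport (1 / (2 + ρ)) 0 V y))) ∨
  (∃ c₁ μ : ℝ, 0 < c₁ ∧ 0 < μ ∧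
    ∀ P' : E3 → ℝ, Literature.Analysis.FluidPDE.IsSelfSimilarEulerProfile (1 / (2 + ρ)) 0 V P' →
      ∀ h : ℝ, ∃ R₀ : ℝ, ∀ y : E3, R₀ ≤ ‖y‖ → h < Literature.Analysis.FluidPDE.selfSimilarBernoulli (1 / (2 + ρ)) 0 V P' y →
        Literature.Analysis.FluidPDE.curl V y ≠ 0 →
          -(c₁ * ‖y‖ ^ 2) ≤ inner ℝ y (Literature.Analysis.FluidPDE.selfSimilarTransport (1 / (2 + ρ)) 0 V y) →
          inner ℝ y (Literature.Analysis.FluidPDE.selfSimilarTransport (1 / (2 + ρ)) 0 V y) ≤ 0 →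
          2 * P' y + inner ℝ y (gradient P' y) ≤ 2 * h + (2 * (1 / (2 + ρ)) * (1 - 1 / (2 + ρ)) - 2 * c₁ ^ 2 - μ) * ‖y‖ ^ 2) ∨
  (∃ κb a₀ : ℝ, 0 < κb ∧ 0 < a₀ ∧
    ∀ P' : E3 → ℝ, Literature.Analysis.FluidPDE.IsSelfSimilarEulerProfile (1 / (2 + ρ)) 0 V P' →
      ∀ h : ℝ, ∃ R₀ : ℝ, ∀ y : E3, R₀ ≤ ‖y‖ → h < Literature.Analysis.FluidPDE.selfSimilarBernoulli (1 / (2 + ρ)) 0 V P' y →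
        Literature.Analysis.FluidPDE.curl V y ≠ 0 →
          -κb ≤ inner ℝ y (Literature.Analysis.FluidPDE.selfSimilarTransport (1 / (2 + ρ)) 0 V y) →
          inner ℝ y (Literature.Analysis.FluidPDE.selfSimilarTransport (1 / (2 + ρ)) 0 V y) ≤ 0 →
          a₀ ≤ ‖Literature.Analysis.FluidPDE.selfSimilarTransport (1 / (2 + ρ)) 0 V y‖ ^ 2 +
            (1 / (2 + ρ)) * inner ℝ y (Literature.Analysis.FluidPDE.selfSimilarTransport (1 / (2 + ρ)) 0 V y) +
            inner ℝ y (fderiv ℝ V y (Literature.Analysis.FluidPDE.selfSimilarTransport (1 / (2 + ρ)) 0 V y))) ∨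
  (∃ c₁ μ : ℝ, 0 < c₁ ∧ 0 < μ ∧
    ∀ P' : E3 → ℝ, Literature.Analysis.FluidPDE.IsSelfSimilarEulerProfile (1 / (2 + ρ)) 0 V P' →
      ∀ h : ℝ, ∃ R₀ : ℝ, ∀ y : E3, R₀ ≤ ‖y‖ → h < Literature.Analysis.FluidPDE.selfSimilarBernoulli (1 / (2 + ρ)) 0 V P' y →
        Literature.Analysis.FluidPDE.curl V y ≠ 0 →
          -(c₁ * ‖y‖ ^ 2) ≤ inner ℝ y (Literature.Analysis.FluidPDE.selfSimilarTransport (1 / (2 + ρ)) 0 V y) →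
          inner ℝ y (Literature.Analysis.FluidPDE.selfSimilarTransport (1 / (2 + ρ)) 0 V y) ≤ 0 →
          inner ℝ y (gradient P' y) ≤ ‖Literature.Analysis.FluidPDE.selfSimilarTransport (1 / (2 + ρ)) 0 V y‖ ^ 2 +
            ((1 / (2 + ρ)) * (1 - 1 / (2 + ρ)) - 2 * c₁ ^ 2 - μ) * ‖y‖ ^ 2) ∨
  (∃ κb a₀ : ℝ, 0 < κb ∧ 0 < a₀ ∧
    ∀ P' : E3 → ℝ, Literature.Analysis.FluidPDE.IsSelfSimilarEulerProfile (1 / (2 + ρ)) 0 V P' →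
      ∀ h : ℝ, ∃ R₀ : ℝ, ∀ y : E3, R₀ ≤ ‖y‖ → h < Literature.Analysis.FluidPDE.selfSimilarBernoulli (1 / (2 + ρ)) 0 V P' y →
        Literature.Analysis.FluidPDE.curl V y ≠ 0 →
          -κb ≤ inner ℝ y (Literature.Analysis.FluidPDE.selfSimilarTransport (1 / (2 + ρ)) 0 V y) →
          inner ℝ y (Literature.Analysis.FluidPDE.selfSimilarTransport (1 / (2 + ρ)) 0 V y) ≤ 0 →
          2 * P' y + inner ℝ y (gradient P' y) ≤ 2 * h + 2 * (1 / (2 + ρ)) * (1 - 1 / (2 + ρ)) * ‖y‖ ^ 2 - a₀) ∨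
  (∃ κb a₀ : ℝ, 0 < κb ∧ 0 < a₀ ∧
    ∀ P' : E3 → ℝ, Literature.Analysis.FluidPDE.IsSelfSimilarEulerProfile (1 / (2 + ρ)) 0 V P' →
      ∀ h : ℝ, ∃ R₀ : ℝ, ∀ y : E3, R₀ ≤ ‖y‖ → h < Literature.Analysis.FluidPDE.selfSimilarBernoulli (1 / (2 + ρ)) 0 V P' y →
        Literature.Analysis.FluidPDE.curl V y ≠ 0 →
          -κb ≤ inner ℝ y (Literature.Analysis.FluidPDE.selfSimilarTransport (1 / (2 + ρ)) 0 V y) →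
          inner ℝ y (Literature.Analysis.FluidPDE.selfSimilarTransport (1 / (2 + ρ)) 0 V y) ≤ 0 →
          a₀ / ‖y‖ ^ 2 ≤ ‖Literature.Analysis.FluidPDE.selfSimilarTransport (1 / (2 + ρ)) 0 V y‖ ^ 2 +
            (1 / (2 + ρ)) * inner ℝ y (Literature.Analysis.FluidPDE.selfSimilarTransport (1 / (2 + ρ)) 0 V y) +
            inner ℝ y (fderiv ℝ V y (Literature.Analysis.FluidPDE.selfSimilarTransport (1 / (2 + ρ)) 0 V y))) ∨
  (∃ κb a₀ : ℝ, 0 < κb ∧ 0 < a₀ ∧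
    ∀ P' : E3 → ℝ, Literature.Analysis.FluidPDE.IsSelfSimilarEulerProfile (1 / (2 + ρ)) 0 V P' →
      ∀ h : ℝ, ∃ R₀ : ℝ, ∀ y : E3, R₀ ≤ ‖y‖ → h < Literature.Analysis.FluidPDE.selfSimilarBernoulli (1 / (2 + ρ)) 0 V P' y →
        Literature.Analysis.FluidPDE.curl V y ≠ 0 →
          -κb ≤ inner ℝ y (Literature.Analysis.FluidPDE.selfSimilarTransport (1 / (2 + ρ)) 0 V y) → inner ℝ y (Literature.Analysis.FluidPDE.selfSimilarTransport (1 / (2 + ρ)) 0 V y) ≤ 0 →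
          inner ℝ y (gradient P' y) ≤ ‖Literature.Analysis.FluidPDE.selfSimilarTransport (1 / (2 + ρ)) 0 V y‖ ^ 2 +
            (1 / (2 + ρ)) * (1 - 1 / (2 + ρ)) * ‖y‖ ^ 2 - a₀) ∨
  (∃ κb a₀ e₁ e₂ : ℝ, 0 < κb ∧ 0 < a₀ ∧ 0 ≤ e₁ ∧ e₁ < ρ ∧ 0 ≤ e₂ ∧ e₂ < 2 + ρ + e₁ ∧
    ∀ P' : E3 → ℝ, Literature.Analysis.FluidPDE.IsSelfSimilarEulerProfile (1 / (2 + ρ)) 0 V P' →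
      ∀ h : ℝ, ∃ R₀ : ℝ, ∀ y : E3, R₀ ≤ ‖y‖ → h < Literature.Analysis.FluidPDE.selfSimilarBernoulli (1 / (2 + ρ)) 0 V P' y →
        Literature.Analysis.FluidPDE.curl V y ≠ 0 →
          -(κb * ‖y‖ ^ (-e₁)) ≤ inner ℝ y (Literature.Analysis.FluidPDE.selfSimilarTransport (1 / (2 + ρ)) 0 V y) → inner ℝ y (Literature.Analysis.FluidPDE.selfSimilarTransport (1 / (2 + ρ)) 0 V y) ≤ 0 →
          a₀ * ‖y‖ ^ (-e₂) ≤ ‖Literature.Analysis.FluidPDE.selfSimilarTransport (1 / (2 + ρ)) 0 V y‖ ^ 2 +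
            (1 / (2 + ρ)) * inner ℝ y (Literature.Analysis.FluidPDE.selfSimilarTransport (1 / (2 + ρ)) 0 V y) +
            inner ℝ y (fderiv ℝ V y (Literature.Analysis.FluidPDE.selfSimilarTransport (1 / (2 + ρ)) 0 V y))) ∨
  (∀ P' : E3 → ℝ, Literature.Analysis.FluidPDE.IsSelfSimilarEulerProfile (1 / (2 + ρ)) 0 V P' →
      ∃ O : Set E3, IsOpen O ∧
        (∀ (Z : ℝ → E3) (t : ℝ), 0 ≤ t →
          (∀ s ∈ Set.Icc 0 t, HasDerivAt Z (-(Literature.Analysis.FluidPDE.selfSimilarTransport (1 / (2 + ρ)) 0 V (Z s))) s) → Z 0 ∈ O → Z t ∈ O) ∧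
        (∃ x₁ ∈ O, Literature.Analysis.FluidPDE.curl V x₁ ≠ 0) ∧
        ∃ κb a₀ e₁ e₂ Rf : ℝ, 0 < κb ∧ 0 < a₀ ∧ 0 ≤ e₁ ∧ e₁ < ρ ∧ 0 ≤ e₂ ∧ e₂ < 2 + ρ + e₁ ∧
          ∀ y ∈ O, Rf ≤ ‖y‖ → Literature.Analysis.FluidPDE.curl V y ≠ 0 →
            -(κb * ‖y‖ ^ (-e₁)) ≤ inner ℝ y (Literature.Analysis.FluidPDE.selfSimilarTransport (1 / (2 + ρ)) 0 V y) → inner ℝ y (Literature.Analysis.FluidPDE.selfSimilarTransport (1 / (2 + ρ)) 0 V y) ≤ 0 →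
            a₀ * ‖y‖ ^ (-e₂) ≤ ‖Literature.Analysis.FluidPDE.selfSimilarTransport (1 / (2 + ρ)) 0 V y‖ ^ 2 +
              (1 / (2 + ρ)) * inner ℝ y (Literature.Analysis.FluidPDE.selfSimilarTransport (1 / (2 + ρ)) 0 V y) +
              inner ℝ y (fderiv ℝ V y (Literature.Analysis.FluidPDE.selfSimilarTransport (1 / (2 + ρ)) 0 V y))) ∨
  (∃ κb a₀ e₁ e₂ : ℝ, 0 < κb ∧ 0 < a₀ ∧ 0 ≤ e₁ ∧ e₁ < ρ ∧ 0 ≤ e₂ ∧ e₂ < 2 + ρ + e₁ ∧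
    ∀ P' : E3 → ℝ, Literature.Analysis.FluidPDE.IsSelfSimilarEulerProfile (1 / (2 + ρ)) 0 V P' →
      ∃ x₁ : E3, Literature.Analysis.FluidPDE.curl V x₁ ≠ 0 ∧ ∃ h : ℝ, h < Literature.Analysis.FluidPDE.selfSimilarBernoulli (1 / (2 + ρ)) 0 V P' x₁ ∧
        ∃ R₀ : ℝ, ∀ y : E3, R₀ ≤ ‖y‖ → h < Literature.Analysis.FluidPDE.selfSimilarBernoulli (1 / (2 + ρ)) 0 V P' y →
          Literature.Analysis.FluidPDE.curl V y ≠ 0 →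
            -(κb * ‖y‖ ^ (-e₁)) ≤ inner ℝ y (Literature.Analysis.FluidPDE.selfSimilarTransport (1 / (2 + ρ)) 0 V y) → inner ℝ y (Literature.Analysis.FluidPDE.selfSimilarTransport (1 / (2 + ρ)) 0 V y) ≤ 0 →
            a₀ * ‖y‖ ^ (-e₂) ≤ ‖Literature.Analysis.FluidPDE.selfSimilarTransport (1 / (2 + ρ)) 0 V y‖ ^ 2 +
              (1 / (2 + ρ)) * inner ℝ y (Literature.Analysis.FluidPDE.selfSimilarTransport (1 / (2 + ρ)) 0 V y) +
              inner ℝ y (fderiv ℝ V y (Literature.Analysis.FluidPDE.selfSimilarTransport (1 / (2 + ρ)) 0 V y))) ∨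
  (∀ P' : E3 → ℝ, Literature.Analysis.FluidPDE.IsSelfSimilarEulerProfile (1 / (2 + ρ)) 0 V P' →
      ∃ O : Set E3, IsOpen O ∧
        (∀ (Z : ℝ → E3) (t : ℝ), 0 ≤ t →
          (∀ s ∈ Set.Icc 0 t, HasDerivAt Z (-(Literature.Analysis.FluidPDE.selfSimilarTransport (1 / (2 + ρ)) 0 V (Z s))) s) → Z 0 ∈ O → Z t ∈ O) ∧
        (∃ x₁ ∈ O, Literature.Analysis.FluidPDE.curl V x₁ ≠ 0) ∧
        ∃ E : Set E3,
          (∀ᵐ y ∂(volume : Measure E3), y ∈ O →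
            ∀ (Z : ℝ → E3) (t : ℝ), 0 ≤ t →
              (∀ s ∈ Set.Icc 0 t, HasDerivAt Z (-(Literature.Analysis.FluidPDE.selfSimilarTransport (1 / (2 + ρ)) 0 V (Z s))) s) → Z 0 = y →
                ∀ s ∈ Set.Icc 0 t, Z s ∉ E) ∧
        ∃ κb a₀ e₁ e₂ Rf : ℝ, 0 < κb ∧ 0 < a₀ ∧ 0 ≤ e₁ ∧ e₁ < ρ ∧ 0 ≤ e₂ ∧ e₂ < 2 + ρ + e₁ ∧
          ∀ y ∈ O, y ∉ E → Rf ≤ ‖y‖ → Literature.Analysis.FluidPDE.curl V y ≠ 0 →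
            -(κb * ‖y‖ ^ (-e₁)) ≤ inner ℝ y (Literature.Analysis.FluidPDE.selfSimilarTransport (1 / (2 + ρ)) 0 V y) → inner ℝ y (Literature.Analysis.FluidPDE.selfSimilarTransport (1 / (2 + ρ)) 0 V y) ≤ 0 →
            a₀ * ‖y‖ ^ (-e₂) ≤ ‖Literature.Analysis.FluidPDE.selfSimilarTransport (1 / (2 + ρ)) 0 V y‖ ^ 2 +
              (1 / (2 + ρ)) * inner ℝ y (Literature.Analysis.FluidPDE.selfSimilarTransport (1 / (2 + ρ)) 0 V y) +
              inner ℝ y (fderiv ℝ V y (Literature.Analysis.FluidPDE.selfSimilarTransport (1 / (2 + ρ)) 0 V y)))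

/-- Residence clock, EIGHT alternatives (verbatim `Birth.HasResidenceClock`, ★ v93 = v92 text): (1) LOG clock, (2) POWER clock `c′R^{2+ρ}`, (3)/(4) subcritical strain
clocks, (5) the HOVERING LAW with Bernoulli oscillation exponent `θ_ℋ < 2+ρ`, (6) v88 LOCAL power clock — for every `c′ > 0` ONE ball, centre arbitrary (LEAD g13
`NeedleRace.selfSimilar_ae_eq_zero_of_localPowerClockC2`), (7) v91 envelope `θ < 2+ρ` + LOCAL hovering law at ONE ball (LEAD g13 `…localHoveringLawC2`), (8) v92 «no balanced
perigee ∧ no inflow hovering ∧ no spike above ONE level through ONE vortical point» (ns-ezl-w1 g6 T-D `…perigeeFastEnvelopeC2_level`). -/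
@[reducible] def HasResidenceClock (ρ : ℝ) (V : E3 → E3) : Prop :=
  (∃ s₁ : ℝ, 0 ≤ s₁ ∧ ∀ x₀ : E3, Literature.Analysis.FluidPDE.curl V x₀ ≠ 0 → ∃ r : ℝ, 0 < r ∧ ∃ R₀ : ℝ, ∀ R : ℝ, R₀ ≤ R →
      ∀ (V' : E3 → E3) (K Rbig : ℝ), ContDiff ℝ 2 V' → (∀ y, ‖fderiv ℝ V' y‖ ≤ K) → 2 * R < Rbig →
        (∀ w ∈ Metric.ball (0 : E3) Rbig, V' w = V w) →
        (volume (Metric.ball x₀ r ∩ {y | ∀ σ ∈ Set.Icc 0 (s₁ * Real.log R),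
          ‖Literature.Analysis.ODE.evolutionMap (fun _ : ℝ => Literature.Analysis.FluidPDE.selfSimilarTransport (1 / (2 + ρ)) 0 V') 0 (-σ) y‖ ≤ 2 * R})).toReal ≤
          (volume (Metric.ball x₀ r)).toReal / 2) ∨
  (∀ c' : ℝ, 0 < c' → ∀ x₀ : E3, Literature.Analysis.FluidPDE.curl V x₀ ≠ 0 → ∃ r : ℝ, 0 < r ∧ ∃ R₀ : ℝ, ∀ R : ℝ, R₀ ≤ R →
      ∀ (V' : E3 → E3) (K Rbig : ℝ), ContDiff ℝ 2 V' → (∀ y, ‖fderiv ℝ V' y‖ ≤ K) → 2 * R < Rbig →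
        (∀ w ∈ Metric.ball (0 : E3) Rbig, V' w = V w) →
        (volume (Metric.ball x₀ r ∩ {y | ∀ σ ∈ Set.Icc 0 (c' * R ^ (2 + ρ)),
          ‖Literature.Analysis.ODE.evolutionMap (fun _ : ℝ => Literature.Analysis.FluidPDE.selfSimilarTransport (1 / (2 + ρ)) 0 V') 0 (-σ) y‖ ≤ 2 * R})).toReal ≤
          (volume (Metric.ball x₀ r)).toReal / 2) ∨
  (∃ s : ℝ, s < 1 ∧ (∀ z v : E3, inner ℝ (fderiv ℝ V z v) v ≤ s * ‖v‖ ^ 2) ∧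
    ∀ ε : ℝ, 0 < ε → ∃ R₂ : ℝ, ∀ z : E3, R₂ ≤ ‖z‖ → Real.log ‖Literature.Analysis.FluidPDE.curl V z‖ ≤ ε * ‖z‖ ^ (2 + ρ)) ∨
  (∃ s : ℝ, s < (1 + 2 * ρ) / (2 * (2 + ρ)) ∧ ∀ z v : E3, inner ℝ (fderiv ℝ V z v) v ≤ s * ‖v‖ ^ 2) ∨
  (∃ θ : ℝ, θ < 2 + ρ ∧
    (∀ P' : E3 → ℝ, Literature.Analysis.FluidPDE.IsSelfSimilarEulerProfile (1 / (2 + ρ)) 0 V P' →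
      ∃ C : ℝ, ∀ r : ℝ, 1 ≤ r → ∀ y y' : E3, ‖y‖ ≤ r → ‖y'‖ ≤ r →
        Literature.Analysis.FluidPDE.selfSimilarBernoulli (1 / (2 + ρ)) 0 V P' y - Literature.Analysis.FluidPDE.selfSimilarBernoulli (1 / (2 + ρ)) 0 V P' y' ≤ C * r ^ θ) ∧
    ∀ c' : ℝ, 0 < c' → ∀ x₀ : E3, Literature.Analysis.FluidPDE.curl V x₀ ≠ 0 → ∃ r : ℝ, 0 < r ∧ ∃ R₀ : ℝ,
      ∀ R : ℝ, R₀ ≤ R → ∀ (V' : E3 → E3) (K Rbig : ℝ), ContDiff ℝ 2 V' →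
        (∀ y, ‖fderiv ℝ V' y‖ ≤ K) → 2 * R < Rbig → (∀ w ∈ Metric.ball (0 : E3) Rbig, V' w = V w) →
        (volume (Metric.ball x₀ r ∩ {a | ∀ σ ∈ Set.Icc 0 (c' * R ^ (2 + ρ)), ‖Literature.Analysis.ODE.evolutionMap (fun _ : ℝ => Literature.Analysis.FluidPDE.selfSimilarTransport (1 / (2 + ρ)) 0 V') 0 (-σ) a‖ ≤ 2 * R} ∩
          {a | c' * R ^ (2 + ρ) / 2 ≤ (volume {σ ∈ Set.Icc 0 (c' * R ^ (2 + ρ)) |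
            ‖Literature.Analysis.FluidPDE.selfSimilarTransport (1 / (2 + ρ)) 0 V' (Literature.Analysis.ODE.evolutionMap (fun _ : ℝ => Literature.Analysis.FluidPDE.selfSimilarTransport (1 / (2 + ρ)) 0 V') 0 (-σ) a)‖ < R ^ (-((2 + ρ - θ) / 4))}).toReal})).toReal ≤
          (volume (Metric.ball x₀ r)).toReal / 4) ∨
  (∀ c' : ℝ, 0 < c' → ∃ x₀ : E3, ∃ r : ℝ, 0 < r ∧ ∃ R₀ : ℝ, ∀ R : ℝ, R₀ ≤ R →
      ∀ (V' : E3 → E3) (K Rbig : ℝ), ContDiff ℝ 2 V' → (∀ y, ‖fderiv ℝ V' y‖ ≤ K) → 2 * R < Rbig →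
        (∀ w ∈ Metric.ball (0 : E3) Rbig, V' w = V w) →
        (volume (Metric.ball x₀ r ∩ {y | ∀ σ ∈ Set.Icc 0 (c' * R ^ (2 + ρ)),
          ‖Literature.Analysis.ODE.evolutionMap (fun _ : ℝ => Literature.Analysis.FluidPDE.selfSimilarTransport (1 / (2 + ρ)) 0 V') 0 (-σ) y‖ ≤ 2 * R})).toReal ≤
          (volume (Metric.ball x₀ r)).toReal / 2) ∨
  (∃ θ : ℝ, θ < 2 + ρ ∧
    (∀ P' : E3 → ℝ, Literature.Analysis.FluidPDE.IsSelfSimilarEulerProfile (1 / (2 + ρ)) 0 V P' →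
      ∃ C : ℝ, ∀ r : ℝ, 1 ≤ r → ∀ y y' : E3, ‖y‖ ≤ r → ‖y'‖ ≤ r →
        Literature.Analysis.FluidPDE.selfSimilarBernoulli (1 / (2 + ρ)) 0 V P' y - Literature.Analysis.FluidPDE.selfSimilarBernoulli (1 / (2 + ρ)) 0 V P' y' ≤ C * r ^ θ) ∧
    ∀ c' : ℝ, 0 < c' → ∃ x₀ : E3, ∃ r : ℝ, 0 < r ∧ ∃ R₀ : ℝ,
      ∀ R : ℝ, R₀ ≤ R → ∀ (V' : E3 → E3) (K Rbig : ℝ), ContDiff ℝ 2 V' →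
        (∀ y, ‖fderiv ℝ V' y‖ ≤ K) → 2 * R < Rbig → (∀ w ∈ Metric.ball (0 : E3) Rbig, V' w = V w) →
        (volume (Metric.ball x₀ r ∩ {a | ∀ σ ∈ Set.Icc 0 (c' * R ^ (2 + ρ)), ‖Literature.Analysis.ODE.evolutionMap (fun _ : ℝ => Literature.Analysis.FluidPDE.selfSimilarTransport (1 / (2 + ρ)) 0 V') 0 (-σ) a‖ ≤ 2 * R} ∩
          {a | c' * R ^ (2 + ρ) / 2 ≤ (volume {σ ∈ Set.Icc 0 (c' * R ^ (2 + ρ)) |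
            ‖Literature.Analysis.FluidPDE.selfSimilarTransport (1 / (2 + ρ)) 0 V' (Literature.Analysis.ODE.evolutionMap (fun _ : ℝ => Literature.Analysis.FluidPDE.selfSimilarTransport (1 / (2 + ρ)) 0 V') 0 (-σ) a)‖ < R ^ (-((2 + ρ - θ) / 4))}).toReal})).toReal ≤
          (volume (Metric.ball x₀ r)).toReal / 4) ∨
  (∀ P' : E3 → ℝ, Literature.Analysis.FluidPDE.IsSelfSimilarEulerProfile (1 / (2 + ρ)) 0 V P' →
      ∃ x₁ : E3, Literature.Analysis.FluidPDE.curl V x₁ ≠ 0 ∧ ∃ h : ℝ, h < Literature.Analysis.FluidPDE.selfSimilarBernoulli (1 / (2 + ρ)) 0 V P' x₁ ∧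
        (∃ R₀ : ℝ, ∀ y : E3, R₀ ≤ ‖y‖ → h < Literature.Analysis.FluidPDE.selfSimilarBernoulli (1 / (2 + ρ)) 0 V P' y → Literature.Analysis.FluidPDE.curl V y ≠ 0 →
          inner ℝ y (Literature.Analysis.FluidPDE.selfSimilarTransport (1 / (2 + ρ)) 0 V y) = 0 →
          0 < ‖Literature.Analysis.FluidPDE.selfSimilarTransport (1 / (2 + ρ)) 0 V y‖ ^ 2 + (1 / (2 + ρ)) * inner ℝ y (Literature.Analysis.FluidPDE.selfSimilarTransport (1 / (2 + ρ)) 0 V y) +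
            inner ℝ y (fderiv ℝ V y (Literature.Analysis.FluidPDE.selfSimilarTransport (1 / (2 + ρ)) 0 V y))) ∧
        (∃ w₀ : ℝ, 0 < w₀ ∧ ∃ R₀ : ℝ, ∀ y : E3, R₀ ≤ ‖y‖ → h < Literature.Analysis.FluidPDE.selfSimilarBernoulli (1 / (2 + ρ)) 0 V P' y → Literature.Analysis.FluidPDE.curl V y ≠ 0 →
          inner ℝ y (Literature.Analysis.FluidPDE.selfSimilarTransport (1 / (2 + ρ)) 0 V y) ≤ 0 → w₀ ≤ ‖Literature.Analysis.FluidPDE.selfSimilarTransport (1 / (2 + ρ)) 0 V y‖) ∧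
        (∃ C θ R₀ : ℝ, θ < 2 + ρ ∧ ∀ (r : ℝ) (y y' : E3), R₀ ≤ ‖y‖ → ‖y‖ ≤ r → R₀ ≤ ‖y'‖ → ‖y'‖ ≤ r →
          h < Literature.Analysis.FluidPDE.selfSimilarBernoulli (1 / (2 + ρ)) 0 V P' y → Literature.Analysis.FluidPDE.curl V y ≠ 0 → h < Literature.Analysis.FluidPDE.selfSimilarBernoulli (1 / (2 + ρ)) 0 V P' y' → Literature.Analysis.FluidPDE.curl V y' ≠ 0 →
          Literature.Analysis.FluidPDE.selfSimilarBernoulli (1 / (2 + ρ)) 0 V P' y - Literature.Analysis.FluidPDE.selfSimilarBernoulli (1 / (2 + ρ)) 0 V P' y' ≤ C * r ^ θ))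

/-- Bounded vortical Bernoulli levels + unpressurised vortical far field (verbatim `Birth.HasVorticalBernoulliBound`, v52/v78). -/
@[reducible] def HasVorticalBernoulliBound (ρ : ℝ) (V : E3 → E3) : Prop :=
  ∀ P' : E3 → ℝ, Literature.Analysis.FluidPDE.IsSelfSimilarEulerProfile (1 / (2 + ρ)) 0 V P' →
    (∃ Mb : ℝ, ∀ y : E3, Literature.Analysis.FluidPDE.curl V y ≠ 0 →
        Literature.Analysis.FluidPDE.selfSimilarBernoulli (1 / (2 + ρ)) 0 V P' y ≤ Mb) ∧
    (∃ ε R₀ : ℝ, ε < (1 / (2 + ρ)) * (1 - 1 / (2 + ρ)) / 2 ∧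
        ∀ y : E3, R₀ ≤ ‖y‖ → Literature.Analysis.FluidPDE.curl V y ≠ 0 → P' y ≤ ε * ‖y‖ ^ 2)

/-- Tame vortical Bernoulli levels, growth form (verbatim `Birth.HasTameVorticalBernoulli`, v78). -/
@[reducible] def HasTameVorticalBernoulli (ρ : ℝ) (V : E3 → E3) : Prop :=
  HasVorticalBernoulliBound ρ V ∨
    ((∀ P' : E3 → ℝ, Literature.Analysis.FluidPDE.IsSelfSimilarEulerProfile (1 / (2 + ρ)) 0 V P' →
        ∃ Mb : ℝ, ∀ y : E3, Literature.Analysis.FluidPDE.curl V y ≠ 0 → Literature.Analysis.FluidPDE.selfSimilarBernoulli (1 / (2 + ρ)) 0 V P' y ≤ Mb) ∧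
      (∃ A q R₀ : ℝ, 0 ≤ A ∧ 0 ≤ q ∧ q < 2 + 2 * (1 + 2 * ρ) / 3 ∧
        ∀ z : E3, R₀ ≤ ‖z‖ → Literature.Analysis.FluidPDE.frobeniusNormSq (fderiv ℝ V z) - ‖Literature.Analysis.FluidPDE.curl V z‖ ^ 2 ≤ A * ‖z‖ ^ q))

/-- THE ONE STATEMENT — verbatim `Birth.Sig.stub_selfSimilarC2Needle` (`Lines/birth.lean` v78, open stub of the LEAD skeleton); over the verbatim predicate copies above it is definitionally the LEAD's needle (`Iff.rfl` once both files are in scope). -/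
def Sig.stub_selfSimilarC2Needle : Prop :=
  ∀ ρ : ℝ, 0 < ρ → ρ ≤ 1 / 2 →
    ∀ (u : ℝ → E3 → E3) (p : ℝ → E3 → ℝ) (H : ℝ → E3 → E3 →L[ℝ] E3) (c : ℝ≥0) (V : E3 → E3) (P : E3 → ℝ),
      InClass ρ u p H c → IsExactlySelfSimilar ρ u p V P → IsExtremalProfile ρ V → ContDiff ℝ 2 V →
        ¬ HasBernoulliPiercing ρ V → ¬ HasTameVorticalBernoulli ρ V → ¬ HasFastVorticalChannel ρ V → ¬ HasResidenceClock ρ V →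
        ¬ (∃ R : E3 ≃ₗᵢ[ℝ] E3, Literature.Analysis.FluidPDE.IsAxisymmetric (fun y => R (V (R.symm y)))) →
        Function.uncurry u =ᵐ[volume.restrict (Set.Iio (0 : ℝ) ×ˢ (Set.univ : Set E3))] 0


/-- THE NEEDLE DATA: every hypothesis of `Birth.Sig.stub_selfSimilarC2Needle` EXCEPT the channel binder
`¬ HasFastVorticalChannel ρ V`, bundled (verbatim predicates of `Lines/birth.lean` v78). -/
@[reducible] def NeedleData (ρ : ℝ) (u : ℝ → E3 → E3) (p : ℝ → E3 → ℝ) (H : ℝ → E3 → E3 →L[ℝ] E3)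
    (c : ℝ≥0) (V : E3 → E3) (P : E3 → ℝ) : Prop :=
  InClass ρ u p H c ∧ IsExactlySelfSimilar ρ u p V P ∧ IsExtremalProfile ρ V ∧ ContDiff ℝ 2 V ∧
    ¬ HasBernoulliPiercing ρ V ∧ ¬ HasTameVorticalBernoulli ρ V ∧ ¬ HasResidenceClock ρ V ∧
    ¬ (∃ R : E3 ≃ₗᵢ[ℝ] E3, Literature.Analysis.FluidPDE.IsAxisymmetric (fun y => R (V (R.symm y))))



/-! ## The member's vocabulary (reducible abbreviations; `LocalPowerClock` is alternative (6) of `HasResidenceClock` VERBATIM) -/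

/-- «NO FAR HOVERING above level `h`» with speed floor `w₀` beyond radius `R₁`: every VORTICAL point `y` of `{ℋ_{P′} > h}` with
`‖y‖ ≥ R₁` has similarity speed `‖W(y)‖ = ‖γy + V y‖ ≥ w₀`. -/
@[reducible] def NoFarHovering (ρ : ℝ) (V : E3 → E3) (P' : E3 → ℝ) (h w₀ R₁ : ℝ) : Prop :=
  ∀ y : E3, R₁ ≤ ‖y‖ →
    h < Literature.Analysis.FluidPDE.selfSimilarBernoulli (1 / (2 + ρ)) 0 V P' y →
      Literature.Analysis.FluidPDE.curl V y ≠ 0 →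
        w₀ ≤ ‖Literature.Analysis.FluidPDE.selfSimilarTransport (1 / (2 + ρ)) 0 V y‖

/-- «NO VORTICAL SPIKES above level `h`» with constant `C` and exponent `θ`: for `R ≥ 1`, every VORTICAL point of `{ℋ_{P′} > h}`
in `B̄(0,2R)` has `ℋ_{P′} ≤ h + C R^θ` (growth envelope of the vortical super-level set; the member uses `θ < 2+ρ`). -/
@[reducible] def NoVorticalSpikes (ρ : ℝ) (V : E3 → E3) (P' : E3 → ℝ) (h C θ : ℝ) : Prop :=
  ∀ R : ℝ, 1 ≤ R → ∀ z : E3, ‖z‖ ≤ 2 * R → Literature.Analysis.FluidPDE.curl V z ≠ 0 →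
    h < Literature.Analysis.FluidPDE.selfSimilarBernoulli (1 / (2 + ρ)) 0 V P' z →
      Literature.Analysis.FluidPDE.selfSimilarBernoulli (1 / (2 + ρ)) 0 V P' z ≤ h + C * R ^ θ

/-- The v88 LOCAL POWER CLOCK — alternative (6) of `Birth.HasResidenceClock` VERBATIM (★ v93): for every `c′ > 0` ONE ball
(centre arbitrary) at most half of whose labels stay in `B̄(0,2R)` for backward similarity time `c′R^{2+ρ}` along the cut-off flows,
for all large `R`.  Killed by the LEAD's `NeedleRace.selfSimilar_ae_eq_zero_of_localPowerClockC2` (p676660). -/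
@[reducible] def LocalPowerClock (ρ : ℝ) (V : E3 → E3) : Prop :=
  ∀ c' : ℝ, 0 < c' → ∃ x₀ : E3, ∃ r : ℝ, 0 < r ∧ ∃ R₀ : ℝ, ∀ R : ℝ, R₀ ≤ R →
      ∀ (V' : E3 → E3) (K Rbig : ℝ), ContDiff ℝ 2 V' → (∀ y, ‖fderiv ℝ V' y‖ ≤ K) → 2 * R < Rbig →
        (∀ w ∈ Metric.ball (0 : E3) Rbig, V' w = V w) →
        (volume (Metric.ball x₀ r ∩ {y | ∀ σ ∈ Set.Icc 0 (c' * R ^ (2 + ρ)),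
          ‖Literature.Analysis.ODE.evolutionMap (fun _ : ℝ => Literature.Analysis.FluidPDE.selfSimilarTransport (1 / (2 + ρ)) 0 V') 0 (-σ) y‖ ≤ 2 * R})).toReal ≤
          (volume (Metric.ball x₀ r)).toReal / 2

/-- Alternative (6) IS an alternative of the verbatim `HasResidenceClock` (kernel-checked placement: the sixth of eight disjuncts, ★ v93). -/
theorem hasResidenceClock_of_localPowerClock {ρ : ℝ} {V : E3 → E3} (h6 : LocalPowerClock ρ V) :
    HasResidenceClock ρ V :=
  Or.inr (Or.inr (Or.inr (Or.inr (Or.inr (Or.inl h6)))))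


/-! ## Signatures -/

/-- Signature of `stub_stayersReturn` (PROVABLE, M; deterministic, class-free).  `(V,P′)` a `C²` classical profile at rate
`γ = 1/(2+ρ)`; no far hovering above `h` (floor `w₀ > 0` beyond `R₁`); `m` bounds `ℋ` on the vortical points of `{ℋ > h} ∩ B̄(0,2R)`;
`D ≥ 0` with `m − h ≤ (1−2γ)w₀²D`; `V′` a `C²` globally Lipschitz cut-off copy of `V` on `ball 0 R_big ⊋ B̄(0,2R)`.  Then a label `y`
with `curl V y ≠ 0`, `ℋ(y) > h`, whose backward `W_{V′}`-orbit stays in `B̄(0,2R)` on `[0,T]`, is INSIDE `B(0,R₁)` at some time of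
every window `[a, a+D] ⊆ [0,T]`.  (Else the arc is far, high and vortical throughout the window, `ℋ` gains `≥ (1−2γ)w₀²D ≥ m − h`
on it and exceeds `m` at a vortical high point of `B̄(0,2R)`.)  [this line; tools `ChannelClock.bernoulli_le_of_arc`,
`OutflowDive.vorticityTransport`, CIV (3.31)] -/
def Sig.stub_stayersReturn : Prop :=
  ∀ ρ : ℝ, 0 < ρ → ρ ≤ 1 / 2 →
    ∀ (V : E3 → E3) (P' : E3 → ℝ), ContDiff ℝ 2 V →
      Literature.Analysis.FluidPDE.IsSelfSimilarEulerProfile (1 / (2 + ρ)) 0 V P' →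
      ∀ (h w₀ R₁ : ℝ), 0 < w₀ → NoFarHovering ρ V P' h w₀ R₁ →
      ∀ (R m D : ℝ),
        (∀ z : E3, ‖z‖ ≤ 2 * R → Literature.Analysis.FluidPDE.curl V z ≠ 0 →
          h < Literature.Analysis.FluidPDE.selfSimilarBernoulli (1 / (2 + ρ)) 0 V P' z →
            Literature.Analysis.FluidPDE.selfSimilarBernoulli (1 / (2 + ρ)) 0 V P' z ≤ m) →
        m - h ≤ (1 - 2 * (1 / (2 + ρ))) * w₀ ^ 2 * D → 0 ≤ D →
      ∀ (V' : E3 → E3) (K Rbig : ℝ), ContDiff ℝ 2 V' → (∀ y, ‖fderiv ℝ V' y‖ ≤ K) → 2 * R < Rbig →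
        (∀ w ∈ Metric.ball (0 : E3) Rbig, V' w = V w) →
      ∀ (y : E3) (T : ℝ), Literature.Analysis.FluidPDE.curl V y ≠ 0 →
        h < Literature.Analysis.FluidPDE.selfSimilarBernoulli (1 / (2 + ρ)) 0 V P' y →
        (∀ σ ∈ Set.Icc 0 T,
          ‖Literature.Analysis.ODE.evolutionMap (fun _ : ℝ => Literature.Analysis.FluidPDE.selfSimilarTransport (1 / (2 + ρ)) 0 V') 0 (-σ) y‖ ≤ 2 * R) →
        ∀ a : ℝ, 0 ≤ a → a + D ≤ T →
          ∃ σ ∈ Set.Icc a (a + D),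
            ‖Literature.Analysis.ODE.evolutionMap (fun _ : ℝ => Literature.Analysis.FluidPDE.selfSimilarTransport (1 / (2 + ρ)) 0 V') 0 (-σ) y‖ < R₁

/-- Signature of `stub_cofinalReturnerBounded` (PROVABLE, M; deterministic, class-free — THE LEVER «last exit»).  Under no far hovering
above `h`, a global backward half-orbit `Y` of `W = γy + V` (`Y′ = −W(Y)` on `[0,∞)`, the orbit shape of W3b
`Loc.volume_vortical_boundedBackward_eq_zero`) from a VORTICAL point of `{ℋ > h}` that is in `B(0,R₁)` at arbitrarily late times is
BOUNDED.  (Monotone `ℋ` + cofinal returns ⇒ `lim ℋ(Y t) ≤ max_{B̄(0,R₁)} ℋ` ⇒ finite action `∫₀^∞‖W(Y)‖²`; an unbounded orbit makes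
infinitely many excursions `B(0,R₁) → {‖·‖ ≥ N_k} → B(0,R₁)`, `N_k → ∞`, each far/high/vortical throughout, hence of action
`≥ w₀·2(N_k − R₁)` — summing to `∞`.)  [this line; tools `Loc.bernoulli_comp_sub_eq_of_Ici`, `OutflowDive.vorticityTransport`] -/
def Sig.stub_cofinalReturnerBounded : Prop :=
  ∀ ρ : ℝ, 0 < ρ → ρ ≤ 1 / 2 →
    ∀ (V : E3 → E3) (P' : E3 → ℝ), ContDiff ℝ 2 V →
      Literature.Analysis.FluidPDE.IsSelfSimilarEulerProfile (1 / (2 + ρ)) 0 V P' →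
      ∀ (h w₀ R₁ : ℝ), 0 < w₀ → NoFarHovering ρ V P' h w₀ R₁ →
      ∀ Y : ℝ → E3,
        (∀ t : ℝ, 0 ≤ t → HasDerivAt Y ((-1 : ℝ) • Literature.Analysis.FluidPDE.selfSimilarTransport (1 / (2 + ρ)) 0 V (Y t)) t) →
        Literature.Analysis.FluidPDE.curl V (Y 0) ≠ 0 →
        h < Literature.Analysis.FluidPDE.selfSimilarBernoulli (1 / (2 + ρ)) 0 V P' (Y 0) →
        (∀ S : ℝ, ∃ t : ℝ, S ≤ t ∧ ‖Y t‖ < R₁) →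
          ∃ N : ℝ, ∀ t : ℝ, 0 ≤ t → ‖Y t‖ ≤ N

/-- The standalone content of `stub_lateReturnsVanish`: «LATE RETURNS ARE RARE».  Under no far hovering above `h`, around every
vortical `x₀ ∈ {ℋ > h}` there is a ball `B ⊆ {curl V ≠ 0} ∩ {ℋ > h}` such that for every `ε > 0` and all late times `S ≥ S₀(ε)`,
uniformly in `R` and in the `C²` globally Lipschitz cut-off copy `V′` of `V` on `ball 0 R_big ⊋ B̄(0,2R)`: the labels of `B` whose
backward `W_{V′}`-orbit stays in `B̄(0,2R)` up to some time `σ ≥ S` AT WHICH IT IS IN `B(0,R₁)` weigh at most `ε·vol(B)`. -/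
@[reducible] def LateReturnsVanish : Prop :=
  ∀ ρ : ℝ, 0 < ρ → ρ ≤ 1 / 2 →
    ∀ (V : E3 → E3) (P' : E3 → ℝ), ContDiff ℝ 2 V →
      Literature.Analysis.FluidPDE.IsSelfSimilarEulerProfile (1 / (2 + ρ)) 0 V P' →
      ∀ (h w₀ R₁ : ℝ), 0 < w₀ → NoFarHovering ρ V P' h w₀ R₁ →
      ∀ x₀ : E3, Literature.Analysis.FluidPDE.curl V x₀ ≠ 0 →
        h < Literature.Analysis.FluidPDE.selfSimilarBernoulli (1 / (2 + ρ)) 0 V P' x₀ →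
        ∃ r : ℝ, 0 < r ∧
          Metric.ball x₀ r ⊆ {y | Literature.Analysis.FluidPDE.curl V y ≠ 0 ∧
            h < Literature.Analysis.FluidPDE.selfSimilarBernoulli (1 / (2 + ρ)) 0 V P' y} ∧
          ∀ ε : ℝ, 0 < ε → ∃ S₀ : ℝ, ∀ (S R : ℝ), S₀ ≤ S →
            ∀ (V' : E3 → E3) (K Rbig : ℝ), ContDiff ℝ 2 V' → (∀ y, ‖fderiv ℝ V' y‖ ≤ K) → 2 * R < Rbig →
              (∀ w ∈ Metric.ball (0 : E3) Rbig, V' w = V w) →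
              (volume (Metric.ball x₀ r ∩ {y | ∃ σ : ℝ, S ≤ σ ∧
                  (∀ σ' ∈ Set.Icc 0 σ,
                    ‖Literature.Analysis.ODE.evolutionMap (fun _ : ℝ => Literature.Analysis.FluidPDE.selfSimilarTransport (1 / (2 + ρ)) 0 V') 0 (-σ') y‖ ≤ 2 * R) ∧
                  ‖Literature.Analysis.ODE.evolutionMap (fun _ : ℝ => Literature.Analysis.FluidPDE.selfSimilarTransport (1 / (2 + ρ)) 0 V') 0 (-σ) y‖ < R₁})).toReal ≤
                ε * (volume (Metric.ball x₀ r)).toReal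

/-- Signature of `stub_lateReturnsVanish` (PROVABLE, L; measure bookkeeping): `Sig.stub_cofinalReturnerBounded → LateReturnsVanish`.
(The sets decrease in `S`; a label in all of them has a global backward half-orbit returning to `B(0,R₁)` cofinally, bounded by the
antecedent, so the intersection lies in W3b's null set `Loc.volume_vortical_boundedBackward_eq_zero`; continuity of the measure from
above on the finite-measure ball — step (i) of `ChannelClock.logClock_of_channel` with «confined» replaced by «returns late»; ODE
uniqueness identifies the cut-off orbits inside `ball 0 R_big`.)  [this line]
REV1 PROVER HINT (uniformity in `V′`): the late-return set of `(R, V′, R_big)` with `2R < R_big` equals that of the CANONICAL cut-off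
`V_n` (`Loc.exists_cutoff_local` at radius `n ≥ 2R + 1`), because an orbit staying in `B̄(0,2R)` solves both globally-Lipschitz ODEs
(`V′ = V = V_n` on the open ball `B(0, min(R_big, n))`; `ODE_solution_unique`); so `G(S) := ⋃ₙ {late return after S along ψ⁽ⁿ⁾, staying in
B̄(0,n−1)}` is a countable union of measurable sets, decreasing in `S`, containing every admissible late-return set, and `⋂_S G(S)` consists
of labels whose V-arcs glue (uniqueness on a big ball where `V` is Lipschitz, `ContDiff.locallyLipschitz`) into a GLOBAL orbit with cofinal
returns — bounded by the antecedent, hence W3b-null. 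
-/
def Sig.stub_lateReturnsVanish : Prop :=
  Sig.stub_cofinalReturnerBounded → LateReturnsVanish

/-- THE MEMBER «SPIKES OR HOVERING» (intermediate statement, PROVED below from the three provable stubs): no far hovering above `h`,
no vortical spikes above `h` with exponent `θ < 2+ρ`, and one vortical `x₀` with `ℋ(x₀) > h` ⇒ the v88 LOCAL POWER CLOCK. -/
def Sig.memberSpikesOrHovering : Prop :=
  ∀ ρ : ℝ, 0 < ρ → ρ ≤ 1 / 2 →
    ∀ (V : E3 → E3) (P' : E3 → ℝ), ContDiff ℝ 2 V →
      Literature.Analysis.FluidPDE.IsSelfSimilarEulerProfile (1 / (2 + ρ)) 0 V P' →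
      ∀ (h w₀ R₁ : ℝ), 0 < w₀ → NoFarHovering ρ V P' h w₀ R₁ →
      ∀ (C θ : ℝ), θ < 2 + ρ → NoVorticalSpikes ρ V P' h C θ →
      ∀ x₀ : E3, Literature.Analysis.FluidPDE.curl V x₀ ≠ 0 →
        h < Literature.Analysis.FluidPDE.selfSimilarBernoulli (1 / (2 + ρ)) 0 V P' x₀ →
        LocalPowerClock ρ V

/-- Signature of `stub_hoverFace` (OPEN, XL — the LEAD's condenser face T-E in the form the member consumes): in the needle world,
for every classical pressure, below every vortical Bernoulli value the far vortical super-level set carries a speed floor. -/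
def Sig.stub_hoverFace : Prop :=
  ∀ ρ : ℝ, 0 < ρ → ρ ≤ 1 / 2 →
    ∀ (u : ℝ → E3 → E3) (p : ℝ → E3 → ℝ) (H : ℝ → E3 → E3 →L[ℝ] E3) (c : ℝ≥0) (V : E3 → E3) (P : E3 → ℝ),
      NeedleData ρ u p H c V P → ¬ HasFastVorticalChannel ρ V →
        ∀ P' : E3 → ℝ, Literature.Analysis.FluidPDE.IsSelfSimilarEulerProfile (1 / (2 + ρ)) 0 V P' →
          ∀ x₀ : E3, Literature.Analysis.FluidPDE.curl V x₀ ≠ 0 →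
            ∀ h : ℝ, h < Literature.Analysis.FluidPDE.selfSimilarBernoulli (1 / (2 + ρ)) 0 V P' x₀ →
              ∃ w₀ R₁ : ℝ, 0 < w₀ ∧ NoFarHovering ρ V P' h w₀ R₁

/-- Signature of `stub_spikeFace` (OPEN, L — «NO BERNOULLI SPIKES»; REV1: weakest form the member consumes): in the needle world,
for every classical pressure and every vortical point `x₀` there is SOME level `h < ℋ(x₀)` above which the vortical super-level set has a
growth envelope of exponent `θ < 2+ρ` on the balls `B̄(0,2R)`, `R ≥ 1` (REV0 asked this for EVERY level `h`; since
`NoVorticalSpikes h C θ → NoVorticalSpikes h' C θ` for `h ≤ h'`, REV0 ⇒ REV1). -/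
def Sig.stub_spikeFace : Prop :=
  ∀ ρ : ℝ, 0 < ρ → ρ ≤ 1 / 2 →
    ∀ (u : ℝ → E3 → E3) (p : ℝ → E3 → ℝ) (H : ℝ → E3 → E3 →L[ℝ] E3) (c : ℝ≥0) (V : E3 → E3) (P : E3 → ℝ),
      NeedleData ρ u p H c V P → ¬ HasFastVorticalChannel ρ V →
        ∀ P' : E3 → ℝ, Literature.Analysis.FluidPDE.IsSelfSimilarEulerProfile (1 / (2 + ρ)) 0 V P' →
          ∀ x₀ : E3, Literature.Analysis.FluidPDE.curl V x₀ ≠ 0 →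
            ∃ h : ℝ, h < Literature.Analysis.FluidPDE.selfSimilarBernoulli (1 / (2 + ρ)) 0 V P' x₀ ∧
              ∃ C θ : ℝ, θ < 2 + ρ ∧ NoVorticalSpikes ρ V P' h C θ

/-- Monotonicity of the spike envelope in the level: an envelope above `h` is an envelope above every `h' ≥ h` (so REV0's
«every level» face implies REV1's «some level below `ℋ(x₀)`» face). -/
theorem noVorticalSpikes_mono {ρ : ℝ} {V : E3 → E3} {P' : E3 → ℝ} {h h' C θ : ℝ} (hle : h ≤ h')
    (hS : NoVorticalSpikes ρ V P' h C θ) : NoVorticalSpikes ρ V P' h' C θ := by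
  intro R hR z hz hcurl hh'
  have := hS R hR z hz hcurl (lt_of_le_of_lt hle hh')
  linarith


/-! ## Stubs (sorries = stubs) -/

/-- CLOSED (REV2): LE1 is the tree theorem `LastExit.stayersReturn` (ns-ezl-w1 g6, p680758), the Sig VERBATIM. -/
theorem stub_stayersReturn : Sig.stub_stayersReturn :=
  Summit.NavierStokesRegularity.NavierStokesRegularity.Theorems.PowerGaugeEulerLiouville.LastExit.stayersReturn

/-- CLOSED (REV2): LE2a (the lever) is the tree theorem `LastExit.cofinalReturnerBounded` (ns-ezl-w3 g6 p680805 = ns-ezl-w1 g6 p680963), the Sig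
VERBATIM. -/
theorem stub_cofinalReturnerBounded : Sig.stub_cofinalReturnerBounded :=
  Summit.NavierStokesRegularity.NavierStokesRegularity.Theorems.PowerGaugeEulerLiouville.LastExit.cofinalReturnerBounded

/-- CLOSED (REV2): LE2b — the content `LateReturnsVanish` is the tree theorem `LastExit.lateReturnsVanish` (ns-ezl-w3 g6, file
`…LastExitLateReturns`; it uses LE2a internally), so the implication holds with the antecedent unused. -/
theorem stub_lateReturnsVanish : Sig.stub_lateReturnsVanish :=
  fun _ => Summit.NavierStokesRegularity.NavierStokesRegularity.Theorems.PowerGaugeEulerLiouville.LastExit.lateReturnsVanish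

/-- OPEN (XL): T-E in member form. -/
theorem stub_hoverFace : Sig.stub_hoverFace := by
  sorry

/-- OPEN (L): no Bernoulli spikes. -/
theorem stub_spikeFace : Sig.stub_spikeFace := by
  sorry


/-! ## The member's assembly (CLOSED, no sorry) -/

/-- Power thresholds: for `k > 0` and `θ < e`, `C R^θ ≤ k R^e` for all `R ≥ R₀ ≥ 1`. -/
theorem exists_threshold {k θ e : ℝ} (hk : 0 < k) (hθe : θ < e) (C : ℝ) :
    ∃ R₀ : ℝ, 1 ≤ R₀ ∧ ∀ R : ℝ, R₀ ≤ R → C * R ^ θ ≤ k * R ^ e := by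
  have hd : 0 < e - θ := sub_pos.mpr hθe
  refine ⟨max 1 ((max (C / k) 0) ^ (1 / (e - θ))), le_max_left _ _, fun R hR => ?_⟩
  have hR1 : 1 ≤ R := le_trans (le_max_left _ _) hR
  have hR0 : 0 < R := lt_of_lt_of_le one_pos hR1
  have hbase : 0 ≤ max (C / k) 0 := le_max_right _ _
  -- `R ^ (e - θ) ≥ C / k`
  have hpow : C / k ≤ R ^ (e - θ) := by
    have h1 : (max (C / k) 0) ^ (1 / (e - θ)) ≤ R := le_trans (le_max_right _ _) hR
    have h2 : ((max (C / k) 0) ^ (1 / (e - θ))) ^ (e - θ) ≤ R ^ (e - θ) :=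
      Real.rpow_le_rpow (Real.rpow_nonneg hbase _) h1 hd.le
    have h3 : ((max (C / k) 0) ^ (1 / (e - θ))) ^ (e - θ) = max (C / k) 0 := by
      rw [one_div, Real.rpow_inv_rpow hbase hd.ne']
    rw [h3] at h2
    exact le_trans (le_max_left _ _) h2
  have hCk : C ≤ k * R ^ (e - θ) := by
    have := mul_le_mul_of_nonneg_left hpow hk.le
    rwa [mul_div_cancel₀ _ hk.ne'] at this
  have hsplit : R ^ e = R ^ (e - θ) * R ^ θ := by
    rw [← Real.rpow_add hR0]; ring_nf
  rw [hsplit, ← mul_assoc]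
  exact mul_le_mul_of_nonneg_right hCk (Real.rpow_nonneg hR0.le _)

/-- **THE MEMBER from the stubs** (kernel-checked): `stub_stayersReturn`, `stub_cofinalReturnerBounded`, `stub_lateReturnsVanish` ⇒
`Sig.memberSpikesOrHovering`.  With `T := c′R^{2+ρ}`, `D := T/2`, `m := h + C R^θ` and `R` beyond the two power thresholds
(`C R^θ ≤ (1−2γ)w₀² T/2`, `S₀(½) ≤ T/2`): a staying label of the ball visits `B(0,R₁)` in the window `[T/2, T]` (stub 1), i.e. returns
LATE (`σ ≥ T/2 ≥ S₀`), and late returners weigh at most half the ball (stub 3 fed by stub 2). -/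
theorem member_of (h1 : Sig.stub_stayersReturn) (h2 : Sig.stub_cofinalReturnerBounded) (h3 : Sig.stub_lateReturnsVanish) :
    Sig.memberSpikesOrHovering := by
  intro ρ hρ hρh V P' hV hprof h w₀ R₁ hw₀ hNFH C θ hθe hNS x₀ hx₀ hhx₀
  have hL : LateReturnsVanish := h3 h2
  obtain ⟨r, hr, hball, hlate⟩ := hL ρ hρ hρh V P' hV hprof h w₀ R₁ hw₀ hNFH x₀ hx₀ hhx₀
  obtain ⟨S₀, hS₀⟩ := hlate (1 / 2) (by norm_num)
  intro c' hc'
  -- the two power thresholds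
  have hγ : 0 < 1 - 2 * (1 / (2 + ρ)) := by
    have h2ρ : 0 < 2 + ρ := by linarith
    rw [sub_pos, ← div_eq_mul_one_div, div_lt_one h2ρ]; linarith
  have hk₁ : 0 < (1 - 2 * (1 / (2 + ρ))) * w₀ ^ 2 * (c' / 2) := by positivity
  have hk₂ : 0 < c' / 2 := by positivity
  have he : θ < 2 + ρ := hθe
  obtain ⟨A₁, hA₁, hth₁⟩ := exists_threshold hk₁ he C
  obtain ⟨A₂, hA₂, hth₂⟩ := exists_threshold hk₂ (by linarith : (0 : ℝ) < 2 + ρ) S₀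
  refine ⟨x₀, r, hr, max A₁ A₂, fun R hR V' K Rbig hV' hK hRbig hagree => ?_⟩
  have hR₁' : A₁ ≤ R := le_trans (le_max_left _ _) hR
  have hR₂' : A₂ ≤ R := le_trans (le_max_right _ _) hR
  have hR1 : 1 ≤ R := le_trans hA₁ hR₁'
  have hRpos : 0 < R := lt_of_lt_of_le one_pos hR1
  set T : ℝ := c' * R ^ (2 + ρ) with hT
  have hTnn : 0 ≤ T := by positivity
  -- threshold consequences
  have hD : (h + C * R ^ θ) - h ≤ (1 - 2 * (1 / (2 + ρ))) * w₀ ^ 2 * (T / 2) := by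
    have := hth₁ R hR₁'
    have e1 : (1 - 2 * (1 / (2 + ρ))) * w₀ ^ 2 * (c' / 2) * R ^ (2 + ρ) =
        (1 - 2 * (1 / (2 + ρ))) * w₀ ^ 2 * (T / 2) := by rw [hT]; ring
    linarith [this, e1]
  have hS : S₀ ≤ T / 2 := by
    have h0 := hth₂ R hR₂'
    rw [Real.rpow_zero, mul_one] at h0
    have e1 : c' / 2 * R ^ (2 + ρ) = T / 2 := by rw [hT]; ring
    rw [← e1]; exact h0
  -- the staying labels return late
  have hsub :
      Metric.ball x₀ r ∩ {y | ∀ σ ∈ Set.Icc 0 (c' * R ^ (2 + ρ)),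
          ‖Literature.Analysis.ODE.evolutionMap
              (fun _ : ℝ => Literature.Analysis.FluidPDE.selfSimilarTransport (1 / (2 + ρ)) 0 V') 0 (-σ) y‖ ≤ 2 * R} ⊆
      Metric.ball x₀ r ∩ {y | ∃ σ : ℝ, T / 2 ≤ σ ∧
          (∀ σ' ∈ Set.Icc 0 σ,
            ‖Literature.Analysis.ODE.evolutionMap
                (fun _ : ℝ => Literature.Analysis.FluidPDE.selfSimilarTransport (1 / (2 + ρ)) 0 V') 0 (-σ') y‖ ≤ 2 * R) ∧
          ‖Literature.Analysis.ODE.evolutionMap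
              (fun _ : ℝ => Literature.Analysis.FluidPDE.selfSimilarTransport (1 / (2 + ρ)) 0 V') 0 (-σ) y‖ < R₁} := by
    rintro y ⟨hyB, hstay⟩
    refine ⟨hyB, ?_⟩
    obtain ⟨hcy, hhy⟩ := hball hyB
    have hstay' : ∀ σ ∈ Set.Icc 0 T,
        ‖Literature.Analysis.ODE.evolutionMap
            (fun _ : ℝ => Literature.Analysis.FluidPDE.selfSimilarTransport (1 / (2 + ρ)) 0 V') 0 (-σ) y‖ ≤ 2 * R := by
      simpa [hT] using hstay
    obtain ⟨σ, hσ, hσR₁⟩ :=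
      h1 ρ hρ hρh V P' hV hprof h w₀ R₁ hw₀ hNFH R (h + C * R ^ θ) (T / 2)
        (fun z hz hcz hhz => hNS R hR1 z hz hcz hhz) hD (by positivity)
        V' K Rbig hV' hK hRbig hagree y T hcy hhy hstay' (T / 2) (by positivity) (by linarith)
    refine ⟨σ, hσ.1, fun σ' hσ' => hstay' σ' ⟨hσ'.1, ?_⟩, hσR₁⟩
    have : σ ≤ T / 2 + T / 2 := hσ.2
    linarith [hσ'.2]
  -- measure bookkeeping
  have hfin : volume (Metric.ball x₀ r ∩ {y | ∃ σ : ℝ, T / 2 ≤ σ ∧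
          (∀ σ' ∈ Set.Icc 0 σ,
            ‖Literature.Analysis.ODE.evolutionMap
                (fun _ : ℝ => Literature.Analysis.FluidPDE.selfSimilarTransport (1 / (2 + ρ)) 0 V') 0 (-σ') y‖ ≤ 2 * R) ∧
          ‖Literature.Analysis.ODE.evolutionMap
              (fun _ : ℝ => Literature.Analysis.FluidPDE.selfSimilarTransport (1 / (2 + ρ)) 0 V') 0 (-σ) y‖ < R₁}) ≠ ⊤ :=
    (lt_of_le_of_lt (measure_mono Set.inter_subset_left) measure_ball_lt_top).ne
  have hmono := ENNReal.toReal_mono hfin (measure_mono hsub)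
  have hhalf := hS₀ (T / 2) R hS V' K Rbig hV' hK hRbig hagree
  calc (volume (Metric.ball x₀ r ∩ {y | ∀ σ ∈ Set.Icc 0 (c' * R ^ (2 + ρ)),
          ‖Literature.Analysis.ODE.evolutionMap
              (fun _ : ℝ => Literature.Analysis.FluidPDE.selfSimilarTransport (1 / (2 + ρ)) 0 V') 0 (-σ) y‖ ≤ 2 * R})).toReal
      ≤ _ := hmono
    _ ≤ 1 / 2 * (volume (Metric.ball x₀ r)).toReal := hhalf
    _ = (volume (Metric.ball x₀ r)).toReal / 2 := by ring


/-! ## The needle from the five stubs (kernel-checked, no sorry outside the stubs; REV2: the three provable ones are tree theorems, `member_of` is fed by them) -/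

/-- THE ONE STATEMENT from the stubs: `¬ HasBernoulliPiercing` supplies a classical pressure `P′` and a vortical point `x₀`; the
spike face supplies a level `h < ℋ(x₀)` with no vortical spikes above `h`, the hovering face supplies no-far-hovering above that `h`;
`member_of` supplies the v88 local power clock, an alternative of `HasResidenceClock` — contradiction with `¬ HasResidenceClock`. -/
theorem selfSimilarC2Needle_of (h1 : Sig.stub_stayersReturn) (h2 : Sig.stub_cofinalReturnerBounded)
    (h3 : Sig.stub_lateReturnsVanish) (hH : Sig.stub_hoverFace) (hS : Sig.stub_spikeFace) :
    Sig.stub_selfSimilarC2Needle := by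
  intro ρ hρ hρ' u p H c V P hcls hss hext hC2 hnp hntame hnch hnclock hnaxis
  have hD : NeedleData ρ u p H c V P := ⟨hcls, hss, hext, hC2, hnp, hntame, hnclock, hnaxis⟩
  -- a classical pressure and a vortical point, from `¬ HasBernoulliPiercing`
  have hnp' := hnp
  simp only [HasBernoulliPiercing, not_forall, not_exists, not_and, not_or, not_lt] at hnp'
  obtain ⟨P', hP', h₀, R₁, hpierce⟩ := hnp'
  obtain ⟨x₀, hx₀⟩ : ∃ x : E3, Literature.Analysis.FluidPDE.curl V x ≠ 0 := by
    obtain ⟨y, hyR, hyin, hcurl, _⟩ := hpierce R₁ le_rfl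
    exact ⟨y, hcurl⟩
  -- the spike face chooses the level `h < ℋ(x₀)`; the hovering face answers at that level
  obtain ⟨h, hhx₀, C, θ, hθe, hNS⟩ := hS ρ hρ hρ' u p H c V P hD hnch P' hP' x₀ hx₀
  obtain ⟨w₀, R₂, hw₀, hNFH⟩ := hH ρ hρ hρ' u p H c V P hD hnch P' hP' x₀ hx₀ h hhx₀
  have h6 : LocalPowerClock ρ V :=
    member_of h1 h2 h3 ρ hρ hρ' V P' hC2 hP' h w₀ R₂ hw₀ hNFH C θ hθe hNS x₀ hx₀ hhx₀
  exact absurd (hasResidenceClock_of_localPowerClock h6) hnclock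

/-! ## REV2: the member is a THEOREM; the needle follows from the two open faces alone -/

/-- **THE MEMBER «SPIKES OR HOVERING» IS NOW SORRY-FREE** (REV2): LE1, LE2a, LE2b are tree theorems, so `member_of` yields
`Sig.memberSpikesOrHovering` outright — no far hovering above `h` (speed floor `w₀` on far vortical points of `{ℋ > h}`) ∧ no vortical
Bernoulli spikes above `h` (exponent `θ < 2+ρ`) ∧ one vortical `x₀` with `ℋ(x₀) > h` ⇒ the v88 LOCAL POWER CLOCK (alternative (6)).
OFFER → LEAD: as a `HasResidenceClock` alternative it reads «∃ classical P′, ∃ h w₀ R₁ C θ x₀, 0 < w₀ ∧ NoFarHovering ∧ θ < 2+ρ ∧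
NoVorticalSpikes ∧ curl V x₀ ≠ 0 ∧ h < ℋ x₀» (incomparable with alternative (8): no perigee conjunct, hovering in ALL directions). -/
theorem memberSpikesOrHovering : Sig.memberSpikesOrHovering :=
  member_of stub_stayersReturn stub_cofinalReturnerBounded stub_lateReturnsVanish

/-- **THE NEEDLE FROM THE TWO OPEN FACES** (REV2, kernel-checked, no sorry in the proof term other than through the two face stubs when
instantiated): `stub_hoverFace → stub_spikeFace → Sig.stub_selfSimilarC2Needle`. -/
theorem selfSimilarC2Needle_of_faces (hH : Sig.stub_hoverFace) (hS : Sig.stub_spikeFace) : Sig.stub_selfSimilarC2Needle :=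
  selfSimilarC2Needle_of stub_stayersReturn stub_cofinalReturnerBounded stub_lateReturnsVanish hH hS


end Summit.NavierStokesRegularity.NavierStokesRegularity.Cruxes.PowerGaugeEulerLiouville.LastExit
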